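import Literature.NumberTheory.EllipticCurves.BDPAnticyclotomicPAdicLFunction
import Literature.NumberTheory.EllipticCurves.Castella2018.AnticyclotomicSelmerDual
import Literature.NumberTheory.EllipticCurves.Rank1Residual.Predicates
import Literature.NumberTheory.EllipticCurves.CuspFormLFunction
import HarnessLib

/-!
# Castella–Wan, Math. Ann. 389 (2024): §2 Proposition 2.1 (the square-root BDP `p`-adic
# `L`-function `𝓛_𝔭^BDP ∈ Λ^ur` and its interpolation) and §5 **Theorem 5.3** ([CLW22]) — the
# divisibility `char_{Λac}(X^{rel,str})Λ^ur ⊂ (L_p^BDP)` towards the Iwasawa–Greenberg main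
# conjecture 5.2 — as ONE statement-only named fact, at a good SUPERSINGULAR `p ≥ 5` and `N⁻ = 1`,
# in the tree's anticyclotomic currency (`AcSelmer.XAc`, `UnrSeries`, a frame predicate)

Cell `pub/bsd-print-x6` (D-0131 (2) PRINT tier, leaf `ClassX6 ∧ r_an = 0`), typer seat ty1 (gen 1).
HONEST FRAMING: a PUBLISHED theorem typed as a named fact (`def … : Prop`, D-0014; nothing asserted,
no `_holds`, no `sorry`), hypotheses as printed with the RESTRICTIONS (R1)–(R6) below (each making
the typed statement WEAKER than print), page locators on the authors' accepted manuscript; one new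
characterising PREDICATE with a body (`IsCWBDPLFunction`, Prop. 2.1's interpolation property — the
analogue of the tree's `IsBDPLFunction` = Castella 2018 Thm. 3.1) and small PROVED API. Typed ≠
proved ≠ endorsed; BSD is not advanced by this file. Sibling: `SupersingularPConverse.lean` (Thm. A;
its module docstring fixes WHICH TEXT — the journal's, via the authors' accepted MS
`paper:url-7157bd4f7b88` = https://web.math.ucsb.edu/~castella/Perrin-Riou.pdf, 39 pp., "MS p. n",
journal page = MS page + 2594 — and the flags `CW24-text-is-journal`, `CW24-CLW22-addendum`,
`Hid04-gap`, inherited here). This seat re-read MS pp. 5–9, 18–25, 33, 36 (2026-08-27).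

WHY (consumers by name). The one typed input left on the cell's anticyclotomic roads for class X6 at
`p ≥ 5` is the BDP-type lower divisibility (IMC≥) — Summits-side SHAPES
`Summit.BirchSwinnertonDyer.Rank1Residual.X11b.IMCLowerWaldspurgerOnTreeGoodAt` (both ranks; seat p3
of this cell, `Theorems/PrintX6AnticyclotomicRankZero{StepL,OnTreeIMC}.lean`; cell `b2b-bsdres`,
`Supersingular.X6.IMCDivFrameOnErratumData`, `X6RankOneFrameForm.lean`). In REFEREED print that
divisibility at a supersingular `p` exists ONLY at a field `K` with a prime of `N` NON-split (this
result, from [CLW22]); at an all-split `K` it is not in refereed print (BSTW arXiv:2409.01350 Thm.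
9.24, PRE). This file gives the printed result a Lean NAME. It does NOT give (not in print; cell
`b2b-bsdres` CASTELLA-WAN.md §12.5, §17.3, §18.3): (a) the value of `𝓛_𝔭^BDP` at the trivial
character (no such formula in [CW24]); (b) the NORMALISATION CONCORDANCE between Prop. 2.1's
`𝓛_𝔭^BDP` and Castella 2018 Thm. 3.1's `L_p(f)` (`IsBDPLFunction`) — an identity of ideals of
`R₀⟦T⟧`, printed nowhere; a consumer phrased over `IsBDPLFunction` still carries it as a binder.

## Source, VERBATIM (authors' accepted MS; [corpus: paper:url-7157bd4f7b88 p0005–p0008, p0022–p0025])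

§1.3 (MS p. 5): "`rec_L`, `rec_v` … we take their geometric normalization, i.e., `rec_v` sends a
uniformizer `ϖ_v` to a geometric Frobenius". §2 SETTING (MS p. 5): "Throughout this section, we let
`E/ℚ` be an elliptic curve of conductor `N`, let `f ∈ S₂(Γ₀(N))` be the associated newform, and let
`p ≥ 5` be a prime of good reduction for `E`. Let `K` be an imaginary quadratic field with …
discriminant `D_K < 0`. Writing `N = N⁺N⁻` with `N⁺` the largest factor of `N` divisible only by
primes which are split or ramified in `K`, we assume … (gen-H) `N⁻` is the squarefree product of an
even number of primes, and fix an integral ideal `𝔑⁺` such that `𝓞_K/𝔑⁺ = ℤ/N⁺ℤ`. In addition, we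
assume that (spl) `(p) = 𝔭𝔭̄` splits in `K`, with `𝔭` be the prime `K` above `p` induced by `ι_p`.
… `Λ^ac = ℤ_p⟦Γ^ac⟧`, `Λ^ur = Λ^ac ⊗̂_{ℤ_p} ℤ_p^ur` … an algebraic Hecke character `χ` has infinity
type `(ℓ₁, ℓ₂)` if `χ_∞(z) = z^{ℓ₁} z̄^{ℓ₂}` … a locally algebraic `p`-adic character `χ̂ : G_K^ab →
ℂ_p^×` has weight `(ℓ₁, ℓ₂)` if `χ̂(rec_K(a)) = a_𝔭^{ℓ₁} a_𝔭̄^{ℓ₂}` for all `a ∈ (K ⊗ ℚ_p)^×` close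
to `1`" (MS p. 6): "(2.1) `χ(a) = ι_∞ι_p⁻¹(χ̂(rec_K(a)) a_𝔭^{−ℓ₁} a_𝔭̄^{−ℓ₂}) a_∞^{ℓ₁} ā_∞^{ℓ₂}` …
`L(f, χ, s) = L(Π_K ⊗ χ, s − 1/2)`.
**Proposition 2.1.** There exists a square-root `p`-adic `L`-function `𝓛_𝔭^BDP ∈ Λ^ur` characterized
by the following interpolation property. If `N⁻ ≠ 1`, assume that `N` is squarefree. Then for every
locally algebraic character `χ̂ : Γ^ac → ℂ_p^×` of weight `(n, −n)` with `n ∈ ℤ_{>0}` and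
`n ≡ 0 (mod p − 1)` and crystalline at both `𝔭` and `𝔭̄`, we have
`𝓛_𝔭^BDP(χ̂)² = (Ω_p/Ω_K)^{4n} · Γ(n)Γ(n+1) χ(x_{N⁺})⁻¹ / (4(2π)^{2n+1} √D_K^{2n−1}) · α(f,f_B)⁻¹ ×
(1 − a_p χ(x_𝔭̄) p⁻¹ + χ(x_𝔭̄)² p⁻¹)² · L(f, χ, 1)`, where • `x_{N⁺} ∈ 𝔸_K^{∞,×}` is such that
`ord_w(x_{N⁺,w}) = ord_w(𝔑⁺)` for all finite places `w`, • `Ω_p ∈ (ℤ_p^ur)^×` and `Ω_∞ ∈ ℂ^×` are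
CM periods attached to `K` as in [CH18, §2.5] and [JSW17, §4.5.5], • `α(f, f_B) = ⟨f,f⟩/⟨f_B,f_B⟩`
… when `N⁻ ≠ 1`, and `α(f, f_B) = 1` otherwise. *Proof.* … a refinement of the `p`-adic
`L`-function constructed in [BDP13] for `N⁻ = 1` and [HB15] for `N⁻ ≠ 1`. As an element in `Λ^ur`,
the construction of `𝓛_𝔭^BDP` can be found in [BCK21, §4] … from an extension of the construction
in [CH18]." (MS p. 8, (2.2)): "`L_p^BDP := (𝓛_𝔭^BDP)²`."
§5 (MS p. 23): "Keeping the setting from Section 2 … **Definition 5.1** … `X^𝓛` denote[s] the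
Pontryagin dual of `Sel^𝓛(K, 𝐀^ac)` … `Sel^{rel,str}(K, 𝐀^ac)` consists of classes which are
trivial at `𝔭̄` and satisfy no condition at `𝔭`" — at `v ∤ p` the condition is
`H¹_{𝓕_±}(K_v, 𝐀^ac)`, the orthogonal complement of `H¹_{𝓕_±}(K_v, 𝐓^ac) = H¹(K_v, 𝐓^ac)` (§4.2,
MS p. 22), i.e. `0`; `𝐀^ac := T ⊗̂ Hom_{ℤ_p}(Λ^ac, ℚ_p/ℤ_p)` —; "for any character `χ̂` in the
interpolation range … the `p`-adic representation `V_pE ⊗ Ind_K^ℚ(χ̂)` satisfies the Panchishkin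
condition introduced by Greenberg [Gre94] … 5.2 may thus be viewed as an instance of the Iwasawa
main conjectures formulated in op. cit. for `L_p^BDP = (𝓛_𝔭^BDP)²`" ("5.2: `X^{rel,str}` is
`Λ^ac`-torsion, and `char_{Λac}(X^{rel,str})Λ^ur = (L_p^BDP)` as ideals in `Λ^ur`").

> **Theorem 5.3** ([CLW22]). Assume that: (i) `N` is squarefree, (ii) some prime `ℓ ∣ N` is
> non-split in `K`, (iii) if `N` is odd, then `2` splits in `K`. Then `char_{Λac}(X^{rel,str})Λ^ur ⊂
> (L_p^BDP)` in `Λ^ur[1/p]`. If in addition `E[p]` is ramified at every prime `ℓ ∣ N⁻`, then the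
> divisibility holds in `Λ^ur`." (MS pp. 23–24 = journal pp. 2617–2618.)

Printed proof (MS pp. 24–25): "Part (1) of [CLW22, Thm. 8.2.1] yields … (5.2) … [(5.3) [SU14, Prop.
3.9]; (5.4) via Prop. 2.7; [PW11, Lem. A.2], [GV00, Prop. 2.4]] … (5.5) `char_{Λac}(X^{rel,str})
Λ^ur[1/p] ⊂ (L_p^BDP · α(f,f_B))` …, yielding the first claim. Finally, if `E[p]` is ramified at
every prime `ℓ ∣ N⁻` then by [Pra06, p. 912] the term `α(f,f_B)` is a `p`-adic unit …; since
`μ(L_p^BDP) = 0` by Theorem 2.3, … (5.5) holds in `Λ^ur`"; "Without loss of generality, assume that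
`X^{rel,str}` is `Λ^ac`-torsion (otherwise the characteristic ideal … is `(0)` … nothing to show)"
— torsion is NOT asserted; Thm. 2.3 (MS p. 7): "Assume that `E[p]` is absolutely irreducible as a
`G_K`-module. Then `μ(𝓛_𝔭^BDP) = 0`" ([Hsi14, Thm. B] / [Bur17, Thm. B]). SOURCE of Thm. 5.3: the
REFEREED Castella–Liu–Wan, Forum Math. Sigma 10 (2022) e110, journal Thm. 8.2.3 (1) (= arXiv
:2109.08375v1 Thm. 8.2.1 (1), the locator [CW24] uses; cell `bsd-litref/bstw24` typer note
e27aa5f91ae75cfc), whose §5.2 standing hypotheses include "`ρ̄_π|_{G_K}` is irreducible (…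
automatically true if `π` is not ordinary at `p` …)" and whose printed proof was repaired after the
[Hid04, Thm. 3.2] gap by the authors' unrefereed 2024 addendum (`paper:url-a387a1b246fb`, Thm.
5.0.2) — flags `CW24-CLW22-addendum`, `Hid04-gap`, `CW24-Thm53-inherits-CLW22-irredK` (cell
b2b-bsdres CASTELLA-WAN.md §0.2, §9, §17.2), informational.

## RESTRICTIONS of the transcription (each makes the typed statement WEAKER than print)

(R1) `p` good SUPERSINGULAR, `5 ≤ p` (`Rank1Residual.GoodSS W p`) — printed for good `p ≥ 5`; at a
supersingular `p` the tacit inputs of the proof are automatic IN PRINT: CLW22 §5.2's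
`ρ̄|_{G_K}`-irreducibility ("automatically true if `π` is not ordinary"), Thm. 2.3's absolute
irreducibility ([CW24] MS p. 2 "`E[p]` is irreducible as a `G_{ℚ_p}`-module by … Fontaine", MS p. 36
"`N` squarefree and `p` supersingular … implies that the `G_ℚ`-action o[n] `E[p]` is surjective");
it is also where the cell's consumers live.
-- TODO(general form): good ordinary `p ≥ 5` (carry "`ρ̄_{E,p}|_{G_K}` irreducible" explicitly).
(R2) `N⁻ = 1`: EVERY prime `ℓ ∣ N` is split or ramified in `K` (spelled as in
`castella2018_exists_isBDPLFunction`: a prime of `K` of norm `ℓ`). Then (gen-H) holds trivially,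
`α(f, f_B) = 1`, `𝔑⁺ = 𝔑` with `𝓞_K/𝔑 = ℤ/Nℤ` exists as `N` is squarefree ((i)), hypothesis (ii)
says some `ℓ ∣ N` is RAMIFIED (the cell's "erratum-type" fields, `X11b.IsErratumField`; [CW24]'s
own choice "if `N = q`, we consider `K` ramified at `q`", MS p. 33), and the hypothesis of the
integral clause is VACUOUS — so the INTEGRAL inclusion is what is printed and proved there (`α` a
unit, `μ = 0` by Thm. 2.3); the `Λ^ur[1/p]` clause follows (`charIdeal_map_le_rat_of_thm53`).
-- TODO(general form): `N⁻ ≠ 1` (Jacquet–Langlands `f_B`, `α(f,f_B)` [Pra06], `X_{N⁺,N⁻}`).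
(R3) The CM periods `Ω_p ∈ (ℤ_p^ur)^×`, `Ω_K ∈ ℂ^×` ([CH18, §2.5]; Rem. 2.2 `Ω_∞ = 2πi·Ω_K`; the
typed display is the `Ω_K`-form of MS p. 6) are not tree objects: the frame `(Ω_K ≠ 0, Ω_p ∈ R₀ˣ,
L ∈ R₀⟦T⟧)` is quantified EXISTENTIALLY together with the inclusion (the ∃∧-currency of
`BurungaleCastellaSkinner2025.thm124a_…`, `CastellaGrossiLeeSkinner2022.proofThm422_…`).
(R4) The element typed is `L = L_p^BDP = (𝓛_𝔭^BDP)²` ((2.2), the object of 5.2 / 5.3): "`L` is a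
square" is dropped. The factor `χ(x_{N⁺})⁻¹` is dropped from the display: by (2.1) (`x_{N⁺}` has
trivial components at `p`, `∞`) `χ(x_{N⁺}) = ι_∞ι_p⁻¹ χ̂(rec_K(x_{N⁺}))` is the value at `χ̂` of the
group-like `u = rec_K(x_{N⁺})|_{K^ac_∞} ∈ Γ^ac ⊂ (Λ^ac)^×`, so `u · L_p^BDP` satisfies the display
WITHOUT that factor and generates the SAME ideal; the ∃-quantified `L` absorbs `u`.
(R5) ORIENTATION (bsd-eis RULINGS L31/L33, 2026-08-27, on the (C4) verdict of seat bsd-littype-05;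
doc note in `BDPAnticyclotomicPAdicLFunction.lean`): the frame is written in the tree's "family-B"
presentation — over `φ := χ ∘ c` (`c` complex conjugation), of Castella–Hsieh infinity type
`(−n, n)` read through the embedding datum `ι` inducing `𝔭` (tree `HasInfinityType (fun _ ↦ n)
(fun _ ↦ -n)`, the range of `IsBDPLFunction ι 𝔭`; print's `χ` has type / weight `(n, −n)`), with
the multiplier `(1 − a_p χ(x_𝔭̄)p⁻¹ + χ(x_𝔭̄)²p⁻¹)² = (1 − a_p φ(x_𝔭)p⁻¹ + φ(x_𝔭)²p⁻¹)²` read AT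
`𝔭`, `L(f, χ, 1) = L(f, φ, 1)` (Euler product re-indexed `w ↦ w̄`), and the value taken at the tree
point `T = φ̂(γ) − 1 = χ̂(γ)⁻¹ − 1` (`φ̂ = χ̂ ∘ c = χ̂⁻¹` on `Γ^ac`): the typed `L` is
`ι_Λ(u · L_p^BDP)`, `ι_Λ : γ ↦ γ⁻¹` the involution — the same IDEAL as print's up to `ι_Λ`; its
`Λ`-adic partner is the tree's PRECOMPOSITION dual `AcSelmer.XAc (W⁄K) p κ 𝔭̄ ∅ γ` STRICT AT `𝔭̄`
(`𝔭̄ ∋ p`, `𝔭̄ ≠ 𝔭`), whose Selmer group over `K_∞` — trivial above `𝔭̄`, unconstrained above `𝔭`,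
trivial at places prime to `p` (Castella 2018 Def. 2.2, `K_∞`-formulation) — IS Def. 5.1's
`Sel^{rel,str}(K, 𝐀^ac)` by Shapiro's lemma. WHY THIS PAIRING is print's 5.2/5.3 and not its
`ι_Λ`-conjugate: (1) MS p. 23 — `X^{rel,str}` is Greenberg's Selmer group for the family `V_pE ⊗ χ̂`
over the weight-`(n,−n)` range (the Panchishkin sentence), and by MS p. 5's weight convention
(geometric `rec`) `χ̂|_{G_{K_𝔭}}` is an unramified twist of `ε_cyc^{n}` (relaxed at `𝔭`),
`χ̂|_{G_{K_𝔭̄}}` of `ε_cyc^{−n}` (strict at `𝔭̄`); (2) in the tree the fibre of `XAc … 𝔮` at a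
character `r` of `Γ` (`(T·x)(s) = x(conj_γ s) − x(s)`, `AcSelmer.XAc.X_smul_apply`; `conj` a LEFT
action) is dual to the `r(γ)`-eigenspace of `conj_γ`, the image of `Sel_{str 𝔮}(K, E[p^∞] ⊗ r⁻¹)`
(inflation–restriction); matching (1) forces `r = χ̂⁻¹ = φ̂` and `𝔮 = 𝔭̄`; (3) hence print's
`char_{Λac}(X^{rel,str}) = ι_Λ(char_Λ(XAc … 𝔭̄))`, and print's inclusion transported by `ι_Λ` is the
typed one — the layout of every oriented BDP-type binder in the tree (`KellerYin2024.thmD_…_OPEN`,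
`CastellaGrossiLeeSkinner2022.proofThm422_…`, `Castella2018.erratumThm11Reoriented_…_OPEN`). FLAG
`CW24-53-orientation-L33` (informational): steps (1)–(3) are this seat's reading under the ruling,
not a printed sentence; at `T = 0` and for `ι_Λ`-invariant data (μ, λ) the orientations agree.
(R6) `f` of level `N` with `IsNewformOf W f` (`N = N_E`, `IsNewformOf.level_eq_conductorNorm`), `W`
globally minimal (to read `a_p`); `a_p = cuspCoeff f p` inside the frame (as `bdpInterpolationValue`).
Everything else VERBATIM: `K` imaginary quadratic, `D_K = NumberField.discr K`; (spl) with `𝔭 ∋ p`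
tied to `ι` by `k ∈ 𝔭 ↔ ‖ι⁻¹(w.embedding k)‖_p < 1` (as `IsBDPLFunction`); `Γ^ac`, `Λ^ac` = `κ`
anticyclotomic, topological generator `γ`, `Λ = IwasawaAlgebra p = ℤ_p⟦T⟧`, `1 + T ↔ γ` (MS p. 19
"`Y = γ^ac − 1`"); `Λ^ur = UnrSeries p = R₀⟦T⟧` along THE structure map `j : ℤ_p → R₀`; (i)
`Squarefree N`; (ii) `∃ ℓ ∣ N` prime WITHOUT two primes of `K` above it; (iii) `Odd N →` two primes
above `2`; "`χ̂ : Γ^ac → ℂ_p^×` … crystalline at `𝔭`, `𝔭̄`" ↦ `φ` unramified at every finite place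
with avatar `r` (`IsPAdicAvatarOf ι φ r`, geometric Frobenii = [CW24]'s `rec`) factoring through `κ`;
`n > 0`, `p − 1 ∣ n`; `√D_K = D_K^{1/2} ∈ ℂ` (principal branch); "`⊂ (L_p^BDP)` in `Λ^ur`" ↦
`(char_Λ(XAc … 𝔭̄)).map j ≤ (L)`.

NOT TYPED (no tree objects; cell b2b-bsdres CASTELLA-WAN.md §4): Thm. C, 4.8, Thms. 6.2, 6.8–6.10, Lemma
6.5, Thm. A.5 (signed `H¹_±`, `Sel_±(K, 𝐓^ac)`, `X_±`, `z_∞^±`, `Log_±`); Thm. 2.3; Thms. 2.4–2.5, Prop. 2.7.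

## Contents: `cwInterpolationValue` (complex part of Prop. 2.1's display, presentation (R5), without
`(Ω_p)^{4n}`, `χ(x_{N⁺})⁻¹`, `α`); **`IsCWBDPLFunction ι 𝔭 κ γ f D ΩK Ωp L`** (Prop. 2.1's interpolation
property, a PREDICATE) + API; **`thm53_exists_isCWBDPLFunction_charIdeal_map_le`** (THE named fact); PROVED
bookkeeping `exists_isCWBDPLFunction_of_thm53` (Prop. 2.1 alone), `charIdeal_map_le_rat_of_thm53` (`Λ^ur[1/p]`).

## References
* [CastellaWan2023] F. Castella, X. Wan, Math. Ann. 389 (2024) 2595–2636, doi:10.1007/s00208-023-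
  02711-w — §1.3 (MS p. 5), §2 + Prop. 2.1 + Rem. 2.2 + Thm. 2.3 (MS pp. 5–7 = pp. 2599–2601), (2.2),
  Prop. 2.7 (MS p. 8), §4.2 (MS p. 22), Def. 5.1, 5.2, **Thm. 5.3** + proof (MS pp. 23–25 = pp.
  2617–2619), proof of Thm. 6.11 (MS p. 33), App. A (MS p. 36); accepted MS `paper:url-7157bd4f7b88`.
* [CastellaLiuWan2022] Forum Math. Sigma 10 (2022) e110, Thm. 8.2.3 (1) (= arXiv:2109.08375v1 Thm.
  8.2.1 (1)), §5.2; authors' addendum (2024) `paper:url-a387a1b246fb`.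
* [Castella2018] Def. 2.2 (`AcSelmer.XAc`), Thm. 3.1 (`IsBDPLFunction`); [CastellaHsieh2018] §2.5,
  §3.3; [BurungaleCastellaKim2021] §4; [BertoliniDarmonPrasanna2013]; [Hsieh2014] Thm. B.
* Tree: bsd-eis rulings L31/L33 (`Castella2018/AnticyclotomicMainConjectureErratumReoriented.lean`); cell b2b-bsdres `b2b-bsdres-lit-cw/CASTELLA-WAN.md` §4, §12.5, §17–§19.
-/

noncomputable section

open scoped Classical

open PowerSeries WeierstrassCurve NumberField IsDedekindDomain Field
  Literature.NumberTheory.GaloisRepresentations Literature.NumberTheory.EllipticCurves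
  Literature.NumberTheory.EllipticCurves.ModularForms Literature.NumberTheory.EllipticCurves.Rank1Residual
  Literature.NumberTheory.EllipticCurves.Castella2018

namespace Literature.NumberTheory.EllipticCurves.CastellaWan2024

universe u

/-! ### §1 The interpolation frame of Prop. 2.1 (family-B presentation, restrictions R2–R5) -/

section Frame

variable {K : Type u} [Field K] [NumberField K] {N : ℕ}

/-- **The complex part of Castella–Wan's interpolation value** (Prop. 2.1, `Ω_K`-form, MS p. 6) at
a character of the range, in the family-B presentation (module docstring (R5): `φ = χ ∘ c` has
Castella–Hsieh infinity type `(−n, n)`, `φ(x_𝔭) = χ(x_𝔭̄)`, `L(f, φ, 1) = L(f, χ, 1)`), WITHOUT the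
factors `(Ω_p)^{4n}` (put back in `IsCWBDPLFunction`), `χ(x_{N⁺})⁻¹` (absorbed by a unit of `Λ^ac`,
(R4)) and `α(f,f_B)⁻¹` (`= 1` at `N⁻ = 1`, (R2)):
`Γ(n)Γ(n+1) / (4·(2π)^{2n+1}·(√D)^{2n−1}) · (1 − a_p φ(x_𝔭) p⁻¹ + φ(x_𝔭)² p⁻¹)² · L(f, φ, 1) / Ω_K^{4n}`,
with `a_p = a_p(f)` (`cuspCoeff f p`; `p` GOOD, so the printed `p⁻¹` in the last term of the
multiplier is unconditional), `φ(x_𝔭) = heckeValueExtZero φ 𝔭` (`= φ(ϖ_𝔭)`, `φ` unramified),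
`L(f, φ, 1) = rankinSelbergValueHecke f φ 1` (= `L(Π_K ⊗ φ, 1/2)`, the central value, as in
`bdpInterpolationValue`), `D` the discriminant of `K` (`< 0`; `√D = D^{1/2}` the principal branch)
and `Ω_K ∈ ℂ` the complex CM period (a parameter). [cite: CastellaWan2023, Prop. 2.1 (MS p. 6 = p. 2600), Rem. 2.2] -/
def cwInterpolationValue (p : ℕ) (f : CuspForm (CongruenceSubgroup.Gamma0 N) 2)
    (𝔭 : HeightOneSpectrum (𝓞 K)) (φ : HeckeCharacter K) (n : ℕ) (D : ℤ) (ΩK : ℂ) : ℂ :=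
  let φ𝔭 : ℂ := heckeValueExtZero φ 𝔭
  let sqrtD : ℂ := (D : ℂ) ^ ((2 : ℂ)⁻¹)
  Complex.Gamma n * Complex.Gamma (n + 1) /
      (4 * (2 * (Real.pi : ℂ)) ^ (2 * n + 1) * sqrtD ^ (2 * n - 1)) *
    (1 - cuspCoeff f p * φ𝔭 * ((p : ℂ))⁻¹ + φ𝔭 ^ 2 * ((p : ℂ))⁻¹) ^ 2 *
    rankinSelbergValueHecke f φ 1 / ΩK ^ (4 * n)

variable {p : ℕ} [Fact p.Prime]

/-- **Castella–Wan 2024, Proposition 2.1 — the interpolation property of `L_p^BDP = (𝓛_𝔭^BDP)²`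
as a PREDICATE on `L ∈ R₀⟦T⟧ = Λ^ur`** (`1 + T ↔ γ`, `γ` a topological generator of the anticyclotomic
`ℤ_p`-extension cut out by `κ`), in the tree's family-B presentation (module docstring (R4)–(R5); the
intended `L` is `ι_Λ(u · L_p^BDP)`): for every Hecke character `φ` of `K` UNRAMIFIED at all finite
places, of Castella–Hsieh infinity type `(−n, n)` read through the embedding of the infinite place
(tree `HasInfinityType (fun _ ↦ n) (fun _ ↦ -n)` — print's `χ = φ ∘ c` has infinity type / weight
`(n, −n)`), with `n > 0` AND `p − 1 ∣ n` (print: "`n ≡ 0 (mod p − 1)`"), and every `p`-adic avatar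
`r` of `φ` (`IsPAdicAvatarOf ι φ r`, geometric Frobenii — print's normalisation of `rec`, MS p. 5)
factoring through `κ` (print: "`χ̂ : Γ^ac → ℂ_p^×` … crystalline at both `𝔭` and `𝔭̄`"), the value
of `L` at `T = φ̂(γ) − 1` is `ι⁻¹(cwInterpolationValue p f 𝔭 φ n D Ω_K) · Ω_p^{4n}`. Parameters as in
`IsBDPLFunction` plus the discriminant `D`. A characterising predicate; NOT an existence claim and
nothing is asserted (existence is part of the named fact below). Same range as `IsBDPLFunction ι 𝔭`
except for the extra congruence `p − 1 ∣ n` (fewer interpolation points — weaker requirement, as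
printed). [cite: CastellaWan2023, Prop. 2.1 (MS pp. 5–6 = pp. 2599–2600), (2.1), (2.2) (MS p. 8)] -/
def IsCWBDPLFunction (ι : PadicAlgCl p ≃+* ℂ) (𝔭 : HeightOneSpectrum (𝓞 K)) (κ : ZpExtension K p)
    (γ : absoluteGaloisGroup K) (f : CuspForm (CongruenceSubgroup.Gamma0 N) 2) (D : ℤ) (ΩK : ℂ)
    (Ωp : ℂ_[p]) (L : UnrSeries p) : Prop :=
  ∀ (φ : HeckeCharacter K) (n : ℕ), 0 < n → (p - 1) ∣ n →
    (∀ v : HeightOneSpectrum (𝓞 K), φ.IsUnramifiedAt v) →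
    φ.HasInfinityType (fun _ ↦ (n : ℤ)) (fun _ ↦ -(n : ℤ)) →
    ∀ r : FramedGaloisRep K (PadicAlgCl p) 1, IsPAdicAvatarOf ι φ r → FactorsThroughZp κ r →
      L.HasValueAt (avatarValueAt r γ - 1)
        (((ι.symm (cwInterpolationValue p f 𝔭 φ n D ΩK) : PadicAlgCl p) : ℂ_[p]) * Ωp ^ (4 * n))

/-! #### API -/

variable {ι : PadicAlgCl p ≃+* ℂ} {𝔭 : HeightOneSpectrum (𝓞 K)} {κ : ZpExtension K p}
  {γ : absoluteGaloisGroup K} {f : CuspForm (CongruenceSubgroup.Gamma0 N) 2} {D : ℤ} {ΩK : ℂ}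
  {Ωp : ℂ_[p]} {L : UnrSeries p}

/-- Unfolding `IsCWBDPLFunction` at one character of the range: the prescribed value at
`T = φ̂(γ) − 1`. [cite: CastellaWan2023, Prop. 2.1 (MS p. 6)] -/
theorem IsCWBDPLFunction.hasValueAt (hL : IsCWBDPLFunction ι 𝔭 κ γ f D ΩK Ωp L)
    {φ : HeckeCharacter K} {n : ℕ} (hn : 0 < n) (hpn : (p - 1) ∣ n)
    (hunr : ∀ v : HeightOneSpectrum (𝓞 K), φ.IsUnramifiedAt v)
    (hinf : φ.HasInfinityType (fun _ ↦ (n : ℤ)) (fun _ ↦ -(n : ℤ)))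
    {r : FramedGaloisRep K (PadicAlgCl p) 1} (hr : IsPAdicAvatarOf ι φ r)
    (hκ : FactorsThroughZp κ r) :
    L.HasValueAt (avatarValueAt r γ - 1)
      (((ι.symm (cwInterpolationValue p f 𝔭 φ n D ΩK) : PadicAlgCl p) : ℂ_[p]) * Ωp ^ (4 * n)) :=
  hL φ n hn hpn hunr hinf r hr hκ

/-- The prescribed value at a character of the range is unique ("characterized by the following
interpolation property"): any `v` with `L.HasValueAt (φ̂(γ) − 1) v` is Castella–Wan's right-hand
side. [cite: CastellaWan2023, Prop. 2.1 (MS p. 6)] -/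
theorem IsCWBDPLFunction.eq_of_hasValueAt (hL : IsCWBDPLFunction ι 𝔭 κ γ f D ΩK Ωp L)
    {φ : HeckeCharacter K} {n : ℕ} (hn : 0 < n) (hpn : (p - 1) ∣ n)
    (hunr : ∀ v : HeightOneSpectrum (𝓞 K), φ.IsUnramifiedAt v)
    (hinf : φ.HasInfinityType (fun _ ↦ (n : ℤ)) (fun _ ↦ -(n : ℤ)))
    {r : FramedGaloisRep K (PadicAlgCl p) 1} (hr : IsPAdicAvatarOf ι φ r)
    (hκ : FactorsThroughZp κ r) {v : ℂ_[p]} (hv : L.HasValueAt (avatarValueAt r γ - 1) v) :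
    v = ((ι.symm (cwInterpolationValue p f 𝔭 φ n D ΩK) : PadicAlgCl p) : ℂ_[p]) * Ωp ^ (4 * n) :=
  hv.unique (hL.hasValueAt hn hpn hunr hinf hr hκ)

end Frame

/-! ### §2 The named fact: Prop. 2.1 ∧ Thm. 5.3 at a good supersingular `p ≥ 5`, `N⁻ = 1` -/

section Fact

/-- **Castella–Wan, Math. Ann. 389 (2024), Theorem 5.3 ([CLW22]) with Proposition 2.1 — the
divisibility `char_{Λac}(X^{rel,str})Λ^ur ⊂ (L_p^BDP)` towards the Iwasawa–Greenberg equality of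
§5 (statement 5.2 there), at a good SUPERSINGULAR `p ≥ 5` and `N⁻ = 1`.** A PROVED, REFEREED
THEOREM (one-sided divisibility), not a hypothesis of the literature. VERBATIM (MS pp. 23–24): "Assume that:
(i) `N` is squarefree, (ii) some prime `ℓ ∣ N` is non-split in `K`, (iii) if `N` is odd, then `2`
splits in `K`. Then `char_{Λac}(X^{rel,str})Λ^ur ⊂ (L_p^BDP)` in `Λ^ur[1/p]`. If in addition `E[p]`
is ramified at every prime `ℓ ∣ N⁻`, then the divisibility holds in `Λ^ur`", under §2's setting
(MS p. 5: `E/ℚ` of conductor `N` with newform `f`, `p ≥ 5` good, `K` imaginary quadratic, (gen-H),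
`𝔑⁺`, (spl) with `𝔭` induced by `ι_p`; `L_p^BDP = (𝓛_𝔭^BDP)²` of Prop. 2.1 / (2.2); `X^{rel,str}` of
Def. 5.1: no condition at `𝔭`, trivial at `𝔭̄`). TYPED (module docstring, restrictions (R1)–(R6), each
WEAKER than print): `W/ℚ` globally minimal elliptic with newform `f` of level `N`; `5 ≤ p`,
`GoodSS W p` (R1); `K` imaginary quadratic; `p` split with `𝔭 ∋ p` the prime of the embedding datum
`ι` and `𝔭̄ ∋ p`, `𝔭̄ ≠ 𝔭`; EVERY prime `ℓ ∣ N` split or ramified in `K` (R2: `N⁻ = 1`); `κ`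
anticyclotomic with topological generator `γ`; (i) `Squarefree N`; (ii) some prime `ℓ ∣ N` does NOT
have two primes of `K` above it; (iii) `Odd N →` `2` splits. CONCLUSION: a frame
`(Ω_K ≠ 0, Ω_p ∈ R₀ˣ, L ∈ R₀⟦T⟧)` with `IsCWBDPLFunction ι 𝔭 κ γ f D_K Ω_K Ω_p L` (Prop. 2.1 for
`L = ι_Λ(u·L_p^BDP)`, (R3)–(R5)) such that, along THE structure map `j : ℤ_p → R₀` (`j(x) = x` in
`ℂ_p`), `char_Λ(X_ac strict at 𝔭̄)·R₀⟦T⟧ ⊆ (L)` — the INTEGRAL inclusion (the hypothesis of the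
integral clause is vacuous at `N⁻ = 1`, (R2)); `X_ac = AcSelmer.XAc (W⁄K) p κ 𝔭̄ ∅ γ` = Def. 5.1's
`X^{rel,str}` by Shapiro in the tree's orientation (R5, flag `CW24-53-orientation-L33`). Torsion of
`X^{rel,str}` is NOT asserted (print: "otherwise the characteristic ideal … is `(0)` … nothing to
show"). PUBLISHED THEOREM (refereed), source [CLW22] Thm. 8.2.3 (1) (refereed) + authors' 2024
addendum (flags `CW24-CLW22-addendum`, `Hid04-gap`, informational). No `_holds` is to be expected;
consumers take `(h : thm53_exists_isCWBDPLFunction_charIdeal_map_le)`.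
-- TODO(general form): good ordinary `p`; `N⁻ ≠ 1`; the square root `𝓛_𝔭^BDP`; `χ(x_{N⁺})`.
[cite: CastellaWan2023, Thm. 5.3 and its proof (MS pp. 23–25 = pp. 2617–2619), Prop. 2.1 + (2.1)–(2.2) (MS pp. 5–8), Def. 5.1 (MS p. 23), §4.2 (MS p. 22), Thm. 2.3 (MS p. 7)]
[cite: CastellaLiuWan2022, Thm. 8.2.3 (1) (FMS 10 (2022) e110; = arXiv:2109.08375v1 Thm. 8.2.1 (1)), §5.2]
[cite: BurungaleCastellaKim2021, §4 (the construction of `𝓛_𝔭^BDP ∈ Λ^ur`, as cited by Prop. 2.1)]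
[cite: Castella2018, Def. 2.2 (the tree object `AcSelmer.XAc`)] -/
def thm53_exists_isCWBDPLFunction_charIdeal_map_le : Prop :=
  ∀ {p : ℕ} [Fact p.Prime] (ι : PadicAlgCl p ≃+* ℂ) (W : WeierstrassCurve ℚ) [W.IsElliptic]
    [W.IsGloballyMinimal] (K : Type) [Field K] [NumberField K]
    (𝔭 𝔭bar : HeightOneSpectrum (𝓞 K)) (κ : ZpExtension K p) (γ : absoluteGaloisGroup K)
    [Fact (κ.IsTopGenerator γ)] {N : ℕ} [NeZero N] {f : CuspForm (CongruenceSubgroup.Gamma0 N) 2}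
    (_ : IsNewformOf W f),
    5 ≤ p → GoodSS W p →
    IsImaginaryQuadratic K → ((Ideal.span {(p : ℤ)}).primesOver (𝓞 K)).ncard = 2 →
      ((p : ℕ) : 𝓞 K) ∈ 𝔭.asIdeal →
      (∀ (w : InfinitePlace K) (k : 𝓞 K), k ∈ 𝔭.asIdeal ↔ ‖ι.symm (w.embedding (k : K))‖ < 1) →
      ((p : ℕ) : 𝓞 K) ∈ 𝔭bar.asIdeal → 𝔭bar ≠ 𝔭 →
    (∀ ℓ : ℕ, ℓ.Prime → ℓ ∣ N → ∃ v : HeightOneSpectrum (𝓞 K), Ideal.absNorm v.asIdeal = ℓ) →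
    κ.IsAnticyclotomic →
    Squarefree N →
      (∃ ℓ : ℕ, ℓ.Prime ∧ ℓ ∣ N ∧ ((Ideal.span {(ℓ : ℤ)}).primesOver (𝓞 K)).ncard ≠ 2) →
      (Odd N → ((Ideal.span {(2 : ℤ)}).primesOver (𝓞 K)).ncard = 2) →
    ∃ (ΩK : ℂ) (Ωp : (unrIntegers p)ˣ) (L : UnrSeries p),
      ΩK ≠ 0 ∧
      IsCWBDPLFunction ι 𝔭 κ γ f (NumberField.discr K) ΩK ((Ωp : unrIntegers p) : ℂ_[p]) L ∧
      ∀ (j : ℤ_[p] →+* unrIntegers p),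
        (∀ x : ℤ_[p], ((j x : unrIntegers p) : ℂ_[p]) = algebraMap ℚ_[p] ℂ_[p] (x : ℚ_[p])) →
        (AcSelmer.XAc.charIdeal (W.baseChange K) p κ 𝔭bar ∅ γ).map (PowerSeries.map j) ≤
          Ideal.span {L}

end Fact

/-! ### §3 Bookkeeping (PROVED): the frame alone; the `Λ^ur[1/p]` clause -/

section Bookkeeping

variable {p : ℕ} [Fact p.Prime] (ι : PadicAlgCl p ≃+* ℂ) (W : WeierstrassCurve ℚ) [W.IsElliptic]
  [W.IsGloballyMinimal] (K : Type) [Field K] [NumberField K] (𝔭 𝔭bar : HeightOneSpectrum (𝓞 K))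
  (κ : ZpExtension K p) (γ : absoluteGaloisGroup K) [Fact (κ.IsTopGenerator γ)] {N : ℕ} [NeZero N]
  {f : CuspForm (CongruenceSubgroup.Gamma0 N) 2}

/-- **Prop. 2.1 at the fields of Thm. 5.3 (the frame alone)**: under the hypotheses of the named
fact there is a frame `(Ω_K ≠ 0, Ω_p ∈ R₀ˣ, L)` with `IsCWBDPLFunction ι 𝔭 κ γ f D_K Ω_K Ω_p L`.
Bookkeeping projection of the fact. [cite: CastellaWan2023, Prop. 2.1 (MS pp. 5–6)] -/
theorem exists_isCWBDPLFunction_of_thm53 (h : thm53_exists_isCWBDPLFunction_charIdeal_map_le)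
    (hf : IsNewformOf W f) (hp : 5 ≤ p) (hss : GoodSS W p) (hK : IsImaginaryQuadratic K)
    (hspl : ((Ideal.span {(p : ℤ)}).primesOver (𝓞 K)).ncard = 2)
    (h𝔭 : ((p : ℕ) : 𝓞 K) ∈ 𝔭.asIdeal)
    (hι : ∀ (w : InfinitePlace K) (k : 𝓞 K), k ∈ 𝔭.asIdeal ↔ ‖ι.symm (w.embedding (k : K))‖ < 1)
    (h𝔭bar : ((p : ℕ) : 𝓞 K) ∈ 𝔭bar.asIdeal) (hne : 𝔭bar ≠ 𝔭)
    (hHeeg : ∀ ℓ : ℕ, ℓ.Prime → ℓ ∣ N → ∃ v : HeightOneSpectrum (𝓞 K), Ideal.absNorm v.asIdeal = ℓ)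
    (hκ : κ.IsAnticyclotomic) (hN : Squarefree N)
    (hii : ∃ ℓ : ℕ, ℓ.Prime ∧ ℓ ∣ N ∧ ((Ideal.span {(ℓ : ℤ)}).primesOver (𝓞 K)).ncard ≠ 2)
    (hiii : Odd N → ((Ideal.span {(2 : ℤ)}).primesOver (𝓞 K)).ncard = 2) :
    ∃ (ΩK : ℂ) (Ωp : (unrIntegers p)ˣ) (L : UnrSeries p),
      ΩK ≠ 0 ∧
        IsCWBDPLFunction ι 𝔭 κ γ f (NumberField.discr K) ΩK ((Ωp : unrIntegers p) : ℂ_[p]) L := by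
  obtain ⟨ΩK, Ωp, L, hΩ, hL, -⟩ :=
    h ι W K 𝔭 𝔭bar κ γ hf hp hss hK hspl h𝔭 hι h𝔭bar hne hHeeg hκ hN hii hiii
  exact ⟨ΩK, Ωp, L, hΩ, hL⟩

/-- **The `Λ^ur[1/p]` clause of Thm. 5.3** ("`char_{Λac}(X^{rel,str})Λ^ur ⊂ (L_p^BDP)` in
`Λ^ur[1/p]`", i.e. `p^k · char ⊆ (L)` for some `k`) from the integral inclusion of the fact
(`k = 0`). Bookkeeping. [cite: CastellaWan2023, Thm. 5.3 first clause (MS pp. 23–24)] -/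
theorem charIdeal_map_le_rat_of_thm53 (h : thm53_exists_isCWBDPLFunction_charIdeal_map_le)
    (hf : IsNewformOf W f) (hp : 5 ≤ p) (hss : GoodSS W p) (hK : IsImaginaryQuadratic K)
    (hspl : ((Ideal.span {(p : ℤ)}).primesOver (𝓞 K)).ncard = 2)
    (h𝔭 : ((p : ℕ) : 𝓞 K) ∈ 𝔭.asIdeal)
    (hι : ∀ (w : InfinitePlace K) (k : 𝓞 K), k ∈ 𝔭.asIdeal ↔ ‖ι.symm (w.embedding (k : K))‖ < 1)
    (h𝔭bar : ((p : ℕ) : 𝓞 K) ∈ 𝔭bar.asIdeal) (hne : 𝔭bar ≠ 𝔭)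
    (hHeeg : ∀ ℓ : ℕ, ℓ.Prime → ℓ ∣ N → ∃ v : HeightOneSpectrum (𝓞 K), Ideal.absNorm v.asIdeal = ℓ)
    (hκ : κ.IsAnticyclotomic) (hN : Squarefree N)
    (hii : ∃ ℓ : ℕ, ℓ.Prime ∧ ℓ ∣ N ∧ ((Ideal.span {(ℓ : ℤ)}).primesOver (𝓞 K)).ncard ≠ 2)
    (hiii : Odd N → ((Ideal.span {(2 : ℤ)}).primesOver (𝓞 K)).ncard = 2) :
    ∃ (ΩK : ℂ) (Ωp : (unrIntegers p)ˣ) (L : UnrSeries p),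
      ΩK ≠ 0 ∧
        IsCWBDPLFunction ι 𝔭 κ γ f (NumberField.discr K) ΩK ((Ωp : unrIntegers p) : ℂ_[p]) L ∧
        ∀ (j : ℤ_[p] →+* unrIntegers p),
          (∀ x : ℤ_[p], ((j x : unrIntegers p) : ℂ_[p]) = algebraMap ℚ_[p] ℂ_[p] (x : ℚ_[p])) →
          ∃ k : ℕ,
            Ideal.span {C ((p : unrIntegers p) ^ k)} *
                (AcSelmer.XAc.charIdeal (W.baseChange K) p κ 𝔭bar ∅ γ).map (PowerSeries.map j) ≤
              Ideal.span {L} := by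
  obtain ⟨ΩK, Ωp, L, hΩ, hL, hle⟩ :=
    h ι W K 𝔭 𝔭bar κ γ hf hp hss hK hspl h𝔭 hι h𝔭bar hne hHeeg hκ hN hii hiii
  refine ⟨ΩK, Ωp, L, hΩ, hL, fun j hj ↦ ⟨0, ?_⟩⟩
  rw [pow_zero, map_one, Ideal.span_singleton_one, Ideal.top_mul]
  exact hle j hj

end Bookkeeping

end Literature.NumberTheory.EllipticCurves.CastellaWan2024

end
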